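import Mathlib
import Summits.NavierStokesRegularity.FluidComputer.AbcInertiaCIEigenvalues
import Summits.NavierStokesRegularity.FluidComputer.AbcInertiaLoewner

/-!
# INERTIA-3L instantiation — CLASS I twin (instab3 g8; cert-3 g9's `AbcClassI` layer; character-free lemmas
# reused from the class-II files `AbcInertia*`). Part 9: RATIONAL WEIGHTS — Loewner monotonicity of the Schur term, so that a
# certificate computed with a rational majorant `q ≥ √2` discharges (R1) (instab3 g8; rider (i1′) of
# profile-refuter g7, STATUS l.8892, snippet `HOME/profile/refuter/snippets/LoewnerDiagInv.lean`)

HONEST FRAMING (human ruling D-0035): nothing here is a claim about Navier–Stokes blow-up.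
WHAT THIS IS NOT: not NS evidence. MODEL lane (forced-ABC linearisation, class II); finite-dimensional
linear algebra; no certificate, number or census word moves.

Hypothesis (R1) of `AbcInertiaCount.finrank_le_of_inertia_certificate` carries the REAL `√2` in the tail
constants `E_l = |O_l|²/R + a − √2`. A program that prints exact rationals certifies the SAME inequality with
`E'_l = |O_l|²/R + a − q` for a rational `q ≥ √2` (or encloses `√2` in a ball, i3/i4). Since `0 < E' ≤ E` gives
`diag(E⁻¹) ≼ diag(E'⁻¹)` in the Loewner order, `M₀ + ½F₂diag(E'⁻¹)F₂ᵀ ≺ 0 ⇒ M₀ + ½F₂diag(E⁻¹)F₂ᵀ ≺ 0`: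
* `AbcInertia.dotProduct_conjDiag_mulVec`, `AbcInertia.dotProduct_conjDiagInv_mono`, `AbcInertia.form_neg_of_form_neg_smallerWeights`
  (the refuter's snippet, re-proved here);
* `card_classI_eigenfunctions_le_of_inertia_certificate_ratWeights` — the end-to-end class-II theorem with
  (R1) stated for the weights `E'_l = |O_l|²/R + a − q`, `√2 ≤ q < (⌊r_H²⌋+1)/R + a` (then (R3) follows too).

Mathlib + `AbcInertiaEigenvalues`; no new definitions; std axioms. [folklore]
-/

noncomputable section

open scoped BigOperators Matrix
open Finset Matrix MeasureTheory UnitAddTorus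

namespace Summit.NavierStokesRegularity.FluidComputer.AbcInertiaCI

open Literature.Analysis.FunctionSpaces Literature.Analysis.FunctionSpaces.Torus
open Literature.Analysis.FluidPDE
open Summit.NavierStokesRegularity.FluidComputer.AbcClassI
open Summit.NavierStokesRegularity.FluidComputer.AbcClassII (Fam crossForm secOp rotR rotS sgnAct sgnOrbit
  cube extend restrictTo extend_add extend_smul extend_zero rotR_add rotR_smul rotS_add rotS_smul
  crossForm_add crossForm_smul secOp_add secOp_smul restrictTo_add restrictTo_smul Orbit toOrbit onormSq
  osupNorm cubeOrbits nbrOrbits mem_sgnOrbit mem_sgnOrbit_self card_sgnOrbit_le sgnOrbit_eq_of_mem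
  mem_sgnOrbit_comm sgnOrbit_eq_or_disjoint neg_mem_sgnOrbit neg_self_mem_sgnOrbit rotFreqR_mem_sgnOrbit
  rotFreqS_mem_sgnOrbit freqNormSq_eq_of_mem_sgnOrbit supNorm_eq_of_mem_sgnOrbit mem_cube
  mem_cube_iff_supNorm cube_mono sgnOrbit_subset_cube zero_not_mem_sgnOrbit ne_zero_of_mem_sgnOrbit
  toOrbit_val toOrbit_eq_iff mem_cubeOrbits mem_nbrOrbits mem_nbrOrbits_comm card_nbrOrbits_le rotR_apply
  rotS_apply freqNormSq_rotFreq secOp_conj isConjSymm_secOp kdot_secOp mem_iff_of_orbitClosed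
  isConjSymm_cut kdot_cut orbitClosed_cube_ne_zero orbitClosed_shell neg_mem_of_orbitClosed
  isConjSymm_lerayCrossForm kdot_conj conj_eq_zero_of_not_mem linOp_zero_eq conj_theta_neg
  extend_apply_of_mem extend_apply_of_not_mem restrictTo_extend extend_restrictTo extend_sum
  inner_eq_sum_extend inner_conjVec_conjVec conj_sum_inner_of_isConjSymm sum_inner_eq_re_of_isConjSymm
  real_inner_eq_re real_smul_eq norm_lerayCrossForm_le sobolevWeight_one_eq cube_filter_eq_biUnion sum_cube_filter_eq
  onormSq_nonneg)

section Loewner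

variable {ι κ : Type*} [Fintype ι] [Fintype κ] [DecidableEq κ]

end Loewner

/-! ### The end-to-end theorem with rational (or any majorant) weights -/

/-- **INERTIA-3L, END TO END, WITH A MAJORANT `q ≥ √2` IN THE WEIGHTS (class II, classical form).** As
`card_classI_eigenfunctions_le_of_inertia_certificate`, but (R1) is assumed for the weights
`E'_l = |O_l|²/R + a − q` with `√2 ≤ q` and `q < (⌊r_H²⌋ + 1)/R + a` (so `0 < E' ≤ E` on `B`, and (R3) holds). -/
theorem card_classI_eigenfunctions_le_of_inertia_certificate_ratWeights {R a rL rH q : ℝ}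
    {HL HH HB : Finset AbcClassI.Idx} {m : ℕ} (hR : 0 < R) (h0 : 0 ≤ rL) (hLH : rL + 1 ≤ rH)
    (hHL : ∀ i : AbcClassI.Idx, i ∈ HL ↔ onormSq i.1 ≤ rL ^ 2)
    (hHH : ∀ i : AbcClassI.Idx, i ∈ HH ↔ onormSq i.1 ≤ rH ^ 2)
    (hHB : ∀ i : AbcClassI.Idx, i ∈ HB ↔ rH ^ 2 < onormSq i.1 ∧ onormSq i.1 ≤ (rH + 1) ^ 2)
    (GH Ah : Matrix ↥HH ↥HH ℝ) (AHB : Matrix ↥HH ↥HB ℝ) (ABH : Matrix ↥HB ↥HH ℝ) (E' : ↥HB → ℝ)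
    (V : Matrix ↥HH (Fin m) ℝ) (hGH : GHᵀ = GH)
    (hAh : Ah = Matrix.of fun i j : ↥HH => (if i = j then -(onormSq i.1.1 / R) - a else 0) + AbcClassI.amat i.1 j.1)
    (hAHB : AHB = Matrix.of fun (i : ↥HH) (l : ↥HB) => AbcClassI.amat i.1 l.1)
    (hABH : ABH = Matrix.of fun (l : ↥HB) (i : ↥HH) => AbcClassI.amat l.1 i.1)
    (hq : Real.sqrt 2 ≤ q) (hqR : q < ((⌊rH ^ 2⌋₊ : ℝ) + 1) / R + a)
    (hE' : E' = fun l : ↥HB => onormSq l.1.1 / R + a - q)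
    (hR1q : ∀ x : ↥HH → ℝ, x ≠ 0 →
      x ⬝ᵥ ((GH * Ah + Ahᵀ * GH + (1 / 2 : ℝ) • ((GH * AHB + ABHᵀ) * Matrix.diagonal (fun l => (E' l)⁻¹) *
        (GH * AHB + ABHᵀ)ᵀ)) *ᵥ x) < 0)
    (hR2 : ∀ x : ↥HH → ℝ, 0 ≤ x ⬝ᵥ ((GH + V * Vᵀ) *ᵥ x))
    {n : ℕ} (z : Fin n → ℂ) (hz : Function.Injective z)
    (u : Fin n → UnitAddTorus (Fin 3) → EuclideanSpace ℂ (Fin 3))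
    (hu : ∀ k, Torus.LinNSResolventRel (1 / (2 * Real.pi * R)) (Torus.abcFlow 1 1 1) (2 * Real.pi * z k) (u k) 0)
    (hu0 : ∀ k, u k ≠ 0) (hII : ∀ k, IsClassI (mFourierCoeff (u k))) (hre : ∀ k, a ≤ (z k).re) :
    n ≤ m := by
  classical
  have hR3 : Real.sqrt 2 < ((⌊rH ^ 2⌋₊ : ℝ) + 1) / R + a := lt_of_le_of_lt hq hqR
  -- `0 < E' ≤ E` on `B`
  have hE'pos : ∀ l : ↥HB, 0 < E' l := by
    intro l
    rw [hE']
    have hl : rH ^ 2 < onormSq l.1.1 := ((hHB l.1).mp l.2).1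
    obtain ⟨nn, hnn⟩ := AbcInertia.exists_onormSq_eq_natCast l.1.1
    have hfl : ((⌊rH ^ 2⌋₊ : ℝ) + 1) ≤ onormSq l.1.1 := by
      rw [hnn] at hl ⊢
      exact_mod_cast (Nat.floor_lt (sq_nonneg _)).mpr hl
    have := div_le_div_of_nonneg_right hfl hR.le
    show 0 < onormSq l.1.1 / R + a - q
    linarith
  have hle : ∀ l : ↥HB, E' l ≤ (fun l : ↥HB => onormSq l.1.1 / R + a - Real.sqrt 2) l := by
    intro l; rw [hE']; show onormSq l.1.1 / R + a - q ≤ onormSq l.1.1 / R + a - Real.sqrt 2; linarith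
  have hR1 := AbcInertia.form_neg_of_form_neg_smallerWeights (GH * Ah + Ahᵀ * GH) (GH * AHB + ABHᵀ) hE'pos hle hR1q
  exact card_classI_eigenfunctions_le_of_inertia_certificate hR h0 hLH hHL hHH hHB GH Ah AHB ABH
    (fun l : ↥HB => onormSq l.1.1 / R + a - Real.sqrt 2) V hGH hAh hAHB hABH rfl hR1 hR2 hR3 z hz u hu hu0 hII hre

end Summit.NavierStokesRegularity.FluidComputer.AbcInertiaCI

end
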